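import Mathlib
import Summits.Ventures.PercRepro2.SwOutCrossJunctionBaseConn

/-!
# The base read off a core-kind class point is a cross base (blind cell PercRepro2, night-4 g24,
2026-08-28; proofs/NIGHT4-G24.md §3)

**`crossBase_of_coreKind`**: at a core-kind `Q`-point `ζ` of a cross-junction class the base
`baseX ζ`, with the u-arms and the far arms read off it, is a `CrossBase` — every field is one of
the structural lemmas of the previous files (the arms are disjoint components of the extended
hull, the edges at `h` go into arms, the edges at `u` into u-arms or to dropped vertices, the
edges at a dropped vertex to `u`, along `G`, or out of `U`; the colours `baseX_h_edge`,
`baseX_u_edge`, the forcing, `baseX_bdry`; the connectivity `arm_conn_baseX`).  Also: a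
core-kind point has a u-arm of the base (`nonempty_ιX`), and the non-degeneracy hypotheses of the
block theorem `rigid_block_cross` hold (`hFe_baseX`, `strX_subset_U`).
-/

namespace Summit.Ventures.PercRepro2

namespace CrossArm

open Hull LocRows

variable {V : Type*} {E : Type*} [Fintype E] [DecidableEq E]

open scoped Classical

variable {ends : E → Sym2 V} {X : Type*} {U : Set V} {ξ : Config E} {l h o u : V} {p : X → V}
  {G : SimpleGraph X}

section BaseThm

variable (hj : CrossJunction ends U h u p G o) (hl : l ∉ U) {ζ : Config E}
  (hζ : ζ ∈ swOutSide ends l h o U ξ) (hk : CoreKind ends U h u ζ)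
include hj hl hζ hk

/-- A u-arm of the base is an arm of the point without dropped vertices, adjacent to `u`. -/
lemma CrossJunction.uArm_baseX (P : ιX ends h u p (baseX ends h u p ζ)) :
    P.1 ∈ armsC ends h u ζ ∧ (∀ i, p i ∉ P.1) ∧ ∃ e x, ends e = s(u, x) ∧ x ∈ P.1 :=
  mem_uArmsX_iff.1 (by rw [← hj.uArmsX_baseX hl hζ hk]; exact P.2)

/-- A far arm of the base is an arm of the point without dropped vertices, not adjacent to `u`. -/
lemma CrossJunction.farArm_baseX (P : κX ends h u p (baseX ends h u p ζ)) :
    P.1 ∈ armsC ends h u ζ ∧ (∀ i, p i ∉ P.1) ∧ ¬ ∃ e x, ends e = s(u, x) ∧ x ∈ P.1 :=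
  mem_farArmsX_iff.1 (by rw [← hj.farArmsX_baseX hl hζ hk]; exact P.2)

/-- A u-arm and a far arm of the base are different sets. -/
lemma CrossJunction.uArm_ne_farArm (P : ιX ends h u p (baseX ends h u p ζ))
    (Q : κX ends h u p (baseX ends h u p ζ)) : P.1 ≠ Q.1 := by
  intro hPQ
  exact (hj.farArm_baseX hl hζ hk Q).2.2 (hPQ ▸ (hj.uArm_baseX hl hζ hk P).2.2)

/-- An arm vertex of the base lies in an arm of the point without dropped vertices. -/
lemma CrossJunction.exists_arm_of_mem_armsAllX {x : V}
    (hx : x ∈ armsAllX (UX ends h u p (baseX ends h u p ζ)) (FX ends h u p (baseX ends h u p ζ))) :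
    ∃ P ∈ armsC ends h u ζ, (∀ i, p i ∉ P) ∧ x ∈ P := by
  rcases mem_armsAllX_iff.1 hx with ⟨j, hj'⟩ | ⟨k, hk'⟩
  · exact ⟨j.1, (hj.uArm_baseX hl hζ hk j).1, (hj.uArm_baseX hl hζ hk j).2.1, hj'⟩
  · exact ⟨k.1, (hj.farArm_baseX hl hζ hk k).1, (hj.farArm_baseX hl hζ hk k).2.1, hk'⟩

/-- A vertex of an arm of the point without dropped vertices is an arm vertex of the base. -/
lemma CrossJunction.mem_armsAllX_of_arm {P : Set V} (hP : P ∈ armsC ends h u ζ)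
    (hPp : ∀ i, p i ∉ P) {x : V} (hx : x ∈ P) :
    x ∈ armsAllX (UX ends h u p (baseX ends h u p ζ)) (FX ends h u p (baseX ends h u p ζ)) := by
  rw [mem_armsAllX_iff]
  by_cases hadj : ∃ e x, ends e = s(u, x) ∧ x ∈ P
  · refine Or.inl ⟨⟨P, ?_⟩, hx⟩
    rw [hj.uArmsX_baseX hl hζ hk]
    exact mem_uArmsX_iff.2 ⟨hP, hPp, hadj⟩
  · refine Or.inr ⟨⟨P, ?_⟩, hx⟩
    rw [hj.farArmsX_baseX hl hζ hk]
    exact mem_farArmsX_iff.2 ⟨hP, hPp, hadj⟩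

/-- The structure of the base lies in `U`. -/
lemma CrossJunction.strX_subset_U :
    strX h u (UX ends h u p (baseX ends h u p ζ)) p (FX ends h u p (baseX ends h u p ζ)) ⊆ U := by
  have hHU : extHull ends ζ h u ⊆ U := extHull_subset_of_coreKind hζ hk
  rintro x (rfl | rfl | ⟨i, rfl⟩ | hx)
  · exact hj.hhU
  · exact hj.huU
  · exact hj.hpU i
  · obtain ⟨P, hP, -, hxP⟩ := hj.exists_arm_of_mem_armsAllX hl hζ hk hx
    exact hHU (armsC_subset hP x hxP).1

/-- **The base read off a core-kind class point is a cross base.** -/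
theorem CrossJunction.crossBase_of_coreKind :
    CrossBase ends (baseX ends h u p ζ) h u (UX ends h u p (baseX ends h u p ζ)) p G
      (FX ends h u p (baseX ends h u p ζ)) where
  hne_hu := hj.hne_hu
  hne_hp := hj.hne_hp
  hne_up := hj.hne_up
  p_inj := hj.p_inj
  h_notMem_U := fun P hh => (armsC_subset (hj.uArm_baseX hl hζ hk P).1 h hh).2.1 rfl
  u_notMem_U := fun P hu => (armsC_subset (hj.uArm_baseX hl hζ hk P).1 u hu).2.2 rfl
  p_notMem_U := fun i P hp => (hj.uArm_baseX hl hζ hk P).2.1 i hp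
  h_notMem_F := fun P hh => (armsC_subset (hj.farArm_baseX hl hζ hk P).1 h hh).2.1 rfl
  u_notMem_F := fun P hu => (armsC_subset (hj.farArm_baseX hl hζ hk P).1 u hu).2.2 rfl
  p_notMem_F := fun i P hp => (hj.farArm_baseX hl hζ hk P).2.1 i hp
  U_disj := fun P P' hne x hx =>
    armsC_disjoint (hj.uArm_baseX hl hζ hk P).1 (hj.uArm_baseX hl hζ hk P').1
      (fun h' => hne (Subtype.ext h')) x hx
  U_disj_F := fun P Q x hx =>
    armsC_disjoint (hj.uArm_baseX hl hζ hk P).1 (hj.farArm_baseX hl hζ hk Q).1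
      (hj.uArm_ne_farArm hl hζ hk P Q) x hx
  F_disj := fun P P' hne x hx =>
    armsC_disjoint (hj.farArm_baseX hl hζ hk P).1 (hj.farArm_baseX hl hζ hk P').1
      (fun h' => hne (Subtype.ext h')) x hx
  U_nonempty := fun P => armsC_nonempty (hj.uArm_baseX hl hζ hk P).1
  F_nonempty := fun P => armsC_nonempty (hj.farArm_baseX hl hζ hk P).1
  no_cross_UU := fun P P' hne e x y he hx hy =>
    armsC_no_cross (hj.uArm_baseX hl hζ hk P).1 (hj.uArm_baseX hl hζ hk P').1
      (fun h' => hne (Subtype.ext h')) he hx hy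
  no_cross_UF := fun P Q e x y he hx hy =>
    armsC_no_cross (hj.uArm_baseX hl hζ hk P).1 (hj.farArm_baseX hl hζ hk Q).1
      (hj.uArm_ne_farArm hl hζ hk P Q) he hx hy
  no_cross_FF := fun P P' hne e x y he hx hy =>
    armsC_no_cross (hj.farArm_baseX hl hζ hk P).1 (hj.farArm_baseX hl hζ hk P').1
      (fun h' => hne (Subtype.ext h')) he hx hy
  h_edges := fun e x he => by
    have hxH : x ∈ extHull ends ζ h u := by
      cases hc : ζ e with
      | true => exact Or.inl (Or.inl (mem_cluster_of_edge (mem_cluster_self _ _ _) hc he))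
      | false =>
        have hb : blue ζ e = true := by rw [blue_eq_true_iff]; exact hc
        exact Or.inl (Or.inr (mem_cluster_of_edge (mem_cluster_self _ _ _) hb he))
    have hxh : x ≠ h := fun h' => hj.hloop_h e (by rw [he, h'])
    have hxu : x ≠ u := fun h' => hj.hnadj e (by rw [he, h'])
    have hxp : ∀ i, x ≠ p i := fun i h' => hj.hnadj_p i e (by rw [he, h'])
    obtain ⟨P, hP, hPp, hxP⟩ := hj.exists_arm_of_mem_extHull hζ hk hxH hxh hxu hxp
    exact mem_armsAllX_iff.1 (hj.mem_armsAllX_of_arm hl hζ hk hP hPp hxP)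
  u_edges := fun e x he => by
    by_cases hxp : ∃ i, x = p i
    · exact Or.inr hxp
    · have hxH : x ∈ extHull ends ζ h u := BigBlock.p_mem_extHull ⟨e, he⟩ ζ
      have hxh : x ≠ h := fun h' => hj.hnadj e (by rw [he, h', Sym2.eq_swap])
      have hxu : x ≠ u := fun h' => hj.hloop_u e (by rw [he, h'])
      obtain ⟨P, hP, hPp, hxP⟩ := hj.exists_arm_of_mem_extHull hζ hk hxH hxh hxu
        fun i h' => hxp ⟨i, h'⟩
      refine Or.inl ⟨⟨P, ?_⟩, hxP⟩
      rw [hj.uArmsX_baseX hl hζ hk]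
      exact mem_uArmsX_iff.2 ⟨hP, hPp, e, x, he, hxP⟩
  p_edges := fun i e x he => by
    rcases hj.p_nbr he with hxu | ⟨j, hxj, hadj⟩ | hxU
    · exact Or.inl hxu
    · exact Or.inr (Or.inl ⟨j, hxj, hadj⟩)
    · refine Or.inr (Or.inr ⟨fun h' => hxU (h' ▸ hj.hhU), fun h' => hxU (h' ▸ hj.huU),
        fun j h' => hxU (h' ▸ hj.hpU j), fun hx => hxU (hj.strX_subset_U hl hζ hk
          (Or.inr (Or.inr (Or.inr hx))))⟩)
  u_adj_U := fun P => (hj.uArm_baseX hl hζ hk P).2.2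
  h_red := fun e x he => hj.baseX_h_edge hl hζ hk he
  u_red := fun e x he => hj.baseX_u_edge hl hζ hk he
  cross_red := fun _ _ _ he => crossForce_C he
  ext_blue := fun _ e x he hxu hxp => crossForce_Ext hj.hne_up he hxu hxp
  bdry_blue := fun e x y he hx hyh hyu hyp hy => by
    obtain ⟨P, hP, hPp, hxP⟩ := hj.exists_arm_of_mem_armsAllX hl hζ hk hx
    refine hj.baseX_bdry hl hζ hk hP hPp he hxP fun hyH => hy ?_
    obtain ⟨Q, hQ, hQp, hyQ⟩ := hj.exists_arm_of_mem_extHull hζ hk hyH hyh hyu hyp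
    exact hj.mem_armsAllX_of_arm hl hζ hk hQ hQp hyQ
  U_conn := fun P x hx => hj.arm_conn_baseX hl hζ hk (hj.uArm_baseX hl hζ hk P).1
    (hj.uArm_baseX hl hζ hk P).2.1 hx
  F_conn := fun P x hx => hj.arm_conn_baseX hl hζ hk (hj.farArm_baseX hl hζ hk P).1
    (hj.farArm_baseX hl hζ hk P).2.1 hx

/-- **A core-kind point has a u-arm of its base.** -/
theorem CrossJunction.nonempty_ιX : Nonempty (ιX ends h u p (baseX ends h u p ζ)) := by
  obtain ⟨P, hP⟩ := hj.exists_uArmsX hζ hk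
  exact ⟨⟨P, by rw [hj.uArmsX_baseX hl hζ hk]; exact hP⟩⟩

/-- Every far arm of the base carries an edge. -/
lemma CrossJunction.hFe_baseX (k : κX ends h u p (baseX ends h u p ζ)) :
    ∃ e, e ∈ touches ends (k.1) := by
  obtain ⟨hk', -, -⟩ := hj.farArm_baseX hl hζ hk k
  obtain ⟨y, hyH, hyh, hyu, hky⟩ := exists_of_mem_armsC hk'
  -- `y` lies in a cluster of `h` or of `u`, so it carries an edge
  have hy : y ∈ cluster ends ζ h ∨ y ∈ cluster ends (blue ζ) h ∨ y ∈ cluster ends ζ u ∨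
      y ∈ cluster ends (blue ζ) u := by
    rcases hyH with (h' | h') | (h' | h')
    · exact Or.inl h'
    · exact Or.inr (Or.inl h')
    · exact Or.inr (Or.inr (Or.inl h'))
    · exact Or.inr (Or.inr (Or.inr h'))
  have key : ∃ e, y ∈ ends e := by
    rcases hy with h' | h' | h' | h'
    · exact exists_edge_of_mem_cluster h' hyh
    · exact exists_edge_of_mem_cluster h' hyh
    · exact exists_edge_of_mem_cluster h' hyu
    · exact exists_edge_of_mem_cluster h' hyu
  obtain ⟨e, he⟩ := key
  obtain ⟨z, hz⟩ := Sym2.mem_iff_exists.1 he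
  exact ⟨e, y, by rw [hky]; exact mem_armC_self y, z, hz⟩

end BaseThm

end CrossArm

end Summit.Ventures.PercRepro2
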